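import Mathlib
import HarnessLib

/-!
# K3 ENGINE child (stmt-HubbardSuperconductivity-19918 `KLRegimeEngineV14`), stub `stub_engine_scale0`, clause (E4)₀: the SCALE-TELESCOPED
# first-moment sum — increments measured at their own scale `R = 4^m` add up uniformly in the number of scales

Cell gate-hubbard-kl, seat hubbard-kl-k3c1-p2 (g7; child-1 lineage, row «row-0′ twin induction measured from its own constant»).  Pure real
bookkeeping for the (E4)₀ owner (k3c2-p1 lineage) and the generic layer (p2/p3), note HOME/hubbard-kl-k3c1-p2/E4ZERO-COMPOSITION-TELESCOPING.md
(evidence #19 on 19918).  The first spatial moment of the position kernel of a COMPOSED symbol `Φ(k₀,k,e₀(k) − K(k))` (scale-`0` grid covariance,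
sector multipliers) is made uniform in the number `N + 1` of frame pieces by telescoping the composition over the pieces in scale order and
reading increment `m` with the per-piece first-moment law (`Literature/…/TorusFourierFirstMoment`, p3's
`sum_abs_mul_norm_framePosKernel_le_of_derivs`: `M ≤ 6R(πℓ/2 + π²D/(2√2·R) + π³E/(8R²))`) at `R = 4^m`.  Increment `m` has derivative sizes of
the shapes (product rule × Faà di Bruno; the inner third derivative grows like `4^m`, the piece's sup decays like `16^{-m}`)

  `ℓ_m ≤ a₀·16^{-m} + a₁·4^{-m}`,  `D_m ≤ d₀·16^{-m} + d₁·4^{-m} + d₂`,  `E_m ≤ e₀·16^{-m} + e₁·4^{-m} + e₂ + e₃·4^m`,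

and then (this file) `Σ_{m ≤ N} M_m ≤ 6·[π/2·((4/3)a₀ + (N+1)a₁) + π²/(2√2)·((16/15)d₀ + (4/3)d₁ + (N+1)d₂) + π³/8·((64/63)e₀ + (16/15)e₁ + (4/3)e₂ + (N+1)e₃)]`:
only the `m`-constant sizes `a₁, d₂, e₃` are multiplied by `N + 1` (in the KL regime `(N+1)·U² ≤ c/ln 4 + 2U²`), everything else sums geometrically.

* `sum_range_inv_pow_le` — `Σ_{m<n} (r^m)⁻¹ ≤ r/(r−1)` for `r > 1`;
* **`sum_telescoped_firstMoment_le`** — the sum above.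

Bookkeeping only; carrier-free; nothing about the model is asserted.  No definitions, no named facts, no sorry.
-/

noncomputable section

namespace Summit.HubbardSuperconductivity.HubbardSuperconductivity.Theorems.EngineV8

set_option linter.dupNamespace false -- summit = problem name (single-conjunct summit), D-0017

open Real Finset

/-- `Σ_{m < n} (r^m)⁻¹ ≤ r/(r − 1)` for `r > 1` (finite geometric sum). -/
theorem sum_range_inv_pow_le {r : ℝ} (hr : 1 < r) (n : ℕ) : ∑ m ∈ range n, ((r ^ m)⁻¹ : ℝ) ≤ r / (r - 1) := by
  have hr0 : 0 < r := by linarith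
  have hq0 : 0 ≤ r⁻¹ := by positivity
  have hq1 : r⁻¹ < 1 := inv_lt_one_of_one_lt₀ hr
  have h : ∑ m ∈ range n, ((r ^ m)⁻¹ : ℝ) = ∑ m ∈ range n, (r⁻¹) ^ m := sum_congr rfl fun m _ => by rw [inv_pow]
  rw [h]
  have hle : ∑ m ∈ range n, (r⁻¹ : ℝ) ^ m ≤ ∑' m : ℕ, (r⁻¹ : ℝ) ^ m :=
    (summable_geometric_of_lt_one hq0 hq1).sum_le_tsum _ (fun m _ => by positivity)
  rw [tsum_geometric_of_lt_one hq0 hq1] at hle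
  have heq : (1 - r⁻¹)⁻¹ = r / (r - 1) := by
    field_simp
  linarith [heq ▸ hle]

/-- **The scale-telescoped first-moment sum.**  If for every `m ≤ N` the increment's first moment obeys the per-piece law at scale `R = 4^m`,
`M_m ≤ 6·4^m·(π·ℓ_m/2 + π²·D_m/(2√2·4^m) + π³·E_m/(8·(4^m)²))`, with sizes `ℓ_m ≤ a₀16^{-m} + a₁4^{-m}`, `D_m ≤ d₀16^{-m} + d₁4^{-m} + d₂`,
`E_m ≤ e₀16^{-m} + e₁4^{-m} + e₂ + e₃4^m` (the geometrically summed parameters `a₀, d₀, d₁, e₀, e₁, e₂ ≥ 0`), then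
`Σ_{m ≤ N} M_m ≤ 6·[π/2·((4/3)a₀ + (N+1)a₁) + π²/(2√2)·((16/15)d₀ + (4/3)d₁ + (N+1)d₂) + π³/8·((64/63)e₀ + (16/15)e₁ + (4/3)e₂ + (N+1)e₃)]`. -/
theorem sum_telescoped_firstMoment_le (N : ℕ) (M ℓ D E : ℕ → ℝ) {a₀ a₁ d₀ d₁ d₂ e₀ e₁ e₂ e₃ : ℝ}
    (ha₀ : 0 ≤ a₀) (hd₀ : 0 ≤ d₀) (hd₁ : 0 ≤ d₁) (he₀ : 0 ≤ e₀) (he₁ : 0 ≤ e₁) (he₂ : 0 ≤ e₂)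
    (hM : ∀ m ≤ N, M m ≤ 6 * (4 : ℝ) ^ m *
      (π * ℓ m / 2 + π ^ 2 * D m / (2 * Real.sqrt 2 * (4 : ℝ) ^ m) + π ^ 3 * E m / (8 * ((4 : ℝ) ^ m) ^ 2)))
    (hℓ : ∀ m ≤ N, ℓ m ≤ a₀ * ((16 : ℝ) ^ m)⁻¹ + a₁ * ((4 : ℝ) ^ m)⁻¹)
    (hD : ∀ m ≤ N, D m ≤ d₀ * ((16 : ℝ) ^ m)⁻¹ + d₁ * ((4 : ℝ) ^ m)⁻¹ + d₂)
    (hE : ∀ m ≤ N, E m ≤ e₀ * ((16 : ℝ) ^ m)⁻¹ + e₁ * ((4 : ℝ) ^ m)⁻¹ + e₂ + e₃ * (4 : ℝ) ^ m) :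
    ∑ m ∈ range (N + 1), M m ≤
      6 * (π / 2 * (4 / 3 * a₀ + (N + 1) * a₁) + π ^ 2 / (2 * Real.sqrt 2) * (16 / 15 * d₀ + 4 / 3 * d₁ + (N + 1) * d₂) +
        π ^ 3 / 8 * (64 / 63 * e₀ + 16 / 15 * e₁ + 4 / 3 * e₂ + (N + 1) * e₃)) := by
  have hπ := Real.pi_pos
  have hsq2 : (0 : ℝ) < Real.sqrt 2 := Real.sqrt_pos.2 (by norm_num)
  -- per-increment bound with the scale factors distributed
  have hper : ∀ m ∈ range (N + 1), M m ≤
      6 * (π / 2 * (a₀ * ((4 : ℝ) ^ m)⁻¹ + a₁) + π ^ 2 / (2 * Real.sqrt 2) * (d₀ * ((16 : ℝ) ^ m)⁻¹ + d₁ * ((4 : ℝ) ^ m)⁻¹ + d₂) +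
        π ^ 3 / 8 * (e₀ * ((64 : ℝ) ^ m)⁻¹ + e₁ * ((16 : ℝ) ^ m)⁻¹ + e₂ * ((4 : ℝ) ^ m)⁻¹ + e₃)) := by
    intro m hm
    have hmN : m ≤ N := Nat.lt_succ_iff.1 (mem_range.1 hm)
    have h4 : (0 : ℝ) < (4 : ℝ) ^ m := by positivity
    have h16 : (16 : ℝ) ^ m = (4 : ℝ) ^ m * (4 : ℝ) ^ m := by rw [← mul_pow]; norm_num
    have h64 : (64 : ℝ) ^ m = (4 : ℝ) ^ m * (4 : ℝ) ^ m * (4 : ℝ) ^ m := by rw [← mul_pow, ← mul_pow]; norm_num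
    have hℓm := hℓ m hmN
    have hDm := hD m hmN
    have hEm := hE m hmN
    -- `4^m ℓ_m ≤ a₀ 4^{-m} + a₁`
    have hℓ' : (4 : ℝ) ^ m * ℓ m ≤ a₀ * ((4 : ℝ) ^ m)⁻¹ + a₁ := by
      have := mul_le_mul_of_nonneg_left hℓm h4.le
      rw [h16] at this
      have e1 : (4 : ℝ) ^ m * (a₀ * ((4 : ℝ) ^ m * (4 : ℝ) ^ m)⁻¹ + a₁ * ((4 : ℝ) ^ m)⁻¹) = a₀ * ((4 : ℝ) ^ m)⁻¹ + a₁ := by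
        field_simp
      linarith [e1 ▸ this]
    -- `E_m / 4^m ≤ e₀ 64^{-m} + e₁ 16^{-m} + e₂ 4^{-m} + e₃`
    have hE' : E m / (4 : ℝ) ^ m ≤ e₀ * ((64 : ℝ) ^ m)⁻¹ + e₁ * ((16 : ℝ) ^ m)⁻¹ + e₂ * ((4 : ℝ) ^ m)⁻¹ + e₃ := by
      rw [div_le_iff₀ h4, h64, h16]
      have e1 : (e₀ * ((4 : ℝ) ^ m * (4 : ℝ) ^ m * (4 : ℝ) ^ m)⁻¹ + e₁ * ((4 : ℝ) ^ m * (4 : ℝ) ^ m)⁻¹ + e₂ * ((4 : ℝ) ^ m)⁻¹ + e₃) *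
          (4 : ℝ) ^ m = e₀ * ((4 : ℝ) ^ m * (4 : ℝ) ^ m)⁻¹ + e₁ * ((4 : ℝ) ^ m)⁻¹ + e₂ + e₃ * (4 : ℝ) ^ m := by
        field_simp
      rw [e1, ← h16]
      convert hEm using 2
    -- rewrite the per-piece law
    have hMm := hM m hmN
    have e2 : 6 * (4 : ℝ) ^ m * (π * ℓ m / 2 + π ^ 2 * D m / (2 * Real.sqrt 2 * (4 : ℝ) ^ m) + π ^ 3 * E m / (8 * ((4 : ℝ) ^ m) ^ 2)) =
        6 * (π / 2 * ((4 : ℝ) ^ m * ℓ m) + π ^ 2 / (2 * Real.sqrt 2) * D m + π ^ 3 / 8 * (E m / (4 : ℝ) ^ m)) := by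
      field_simp
    rw [e2] at hMm
    have hA : π / 2 * ((4 : ℝ) ^ m * ℓ m) ≤ π / 2 * (a₀ * ((4 : ℝ) ^ m)⁻¹ + a₁) := mul_le_mul_of_nonneg_left hℓ' (by positivity)
    have hB : π ^ 2 / (2 * Real.sqrt 2) * D m ≤ π ^ 2 / (2 * Real.sqrt 2) * (d₀ * ((16 : ℝ) ^ m)⁻¹ + d₁ * ((4 : ℝ) ^ m)⁻¹ + d₂) :=
      mul_le_mul_of_nonneg_left hDm (by positivity)
    have hC : π ^ 3 / 8 * (E m / (4 : ℝ) ^ m) ≤ π ^ 3 / 8 * (e₀ * ((64 : ℝ) ^ m)⁻¹ + e₁ * ((16 : ℝ) ^ m)⁻¹ + e₂ * ((4 : ℝ) ^ m)⁻¹ + e₃) :=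
      mul_le_mul_of_nonneg_left hE' (by positivity)
    linarith
  -- geometric sums
  have g4 : ∑ m ∈ range (N + 1), (((4 : ℝ) ^ m)⁻¹ : ℝ) ≤ 4 / 3 := by
    have := sum_range_inv_pow_le (r := (4 : ℝ)) (by norm_num) (N + 1); norm_num at this ⊢; exact this
  have g16 : ∑ m ∈ range (N + 1), (((16 : ℝ) ^ m)⁻¹ : ℝ) ≤ 16 / 15 := by
    have := sum_range_inv_pow_le (r := (16 : ℝ)) (by norm_num) (N + 1); norm_num at this ⊢; exact this
  have g64 : ∑ m ∈ range (N + 1), (((64 : ℝ) ^ m)⁻¹ : ℝ) ≤ 64 / 63 := by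
    have := sum_range_inv_pow_le (r := (64 : ℝ)) (by norm_num) (N + 1); norm_num at this ⊢; exact this
  have hcard : ∑ _m ∈ range (N + 1), (1 : ℝ) = N + 1 := by rw [sum_const, card_range, nsmul_eq_mul, mul_one]; push_cast; ring
  calc ∑ m ∈ range (N + 1), M m
      ≤ ∑ m ∈ range (N + 1), 6 * (π / 2 * (a₀ * ((4 : ℝ) ^ m)⁻¹ + a₁) +
          π ^ 2 / (2 * Real.sqrt 2) * (d₀ * ((16 : ℝ) ^ m)⁻¹ + d₁ * ((4 : ℝ) ^ m)⁻¹ + d₂) +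
          π ^ 3 / 8 * (e₀ * ((64 : ℝ) ^ m)⁻¹ + e₁ * ((16 : ℝ) ^ m)⁻¹ + e₂ * ((4 : ℝ) ^ m)⁻¹ + e₃)) := sum_le_sum hper
    _ = 6 * (π / 2 * (a₀ * ∑ m ∈ range (N + 1), ((4 : ℝ) ^ m)⁻¹ + a₁ * ∑ _m ∈ range (N + 1), (1 : ℝ)) +
          π ^ 2 / (2 * Real.sqrt 2) * (d₀ * ∑ m ∈ range (N + 1), ((16 : ℝ) ^ m)⁻¹ + d₁ * ∑ m ∈ range (N + 1), ((4 : ℝ) ^ m)⁻¹ +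
            d₂ * ∑ _m ∈ range (N + 1), (1 : ℝ)) +
          π ^ 3 / 8 * (e₀ * ∑ m ∈ range (N + 1), ((64 : ℝ) ^ m)⁻¹ + e₁ * ∑ m ∈ range (N + 1), ((16 : ℝ) ^ m)⁻¹ +
            e₂ * ∑ m ∈ range (N + 1), ((4 : ℝ) ^ m)⁻¹ + e₃ * ∑ _m ∈ range (N + 1), (1 : ℝ))) := by
        simp only [mul_sum, ← sum_add_distrib]
        refine sum_congr rfl fun m _ => ?_
        ring
    _ ≤ _ := by
        rw [hcard]
        have t1 : a₀ * ∑ m ∈ range (N + 1), ((4 : ℝ) ^ m)⁻¹ ≤ a₀ * (4 / 3) := mul_le_mul_of_nonneg_left g4 ha₀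
        have t2 : d₀ * ∑ m ∈ range (N + 1), ((16 : ℝ) ^ m)⁻¹ ≤ d₀ * (16 / 15) := mul_le_mul_of_nonneg_left g16 hd₀
        have t3 : d₁ * ∑ m ∈ range (N + 1), ((4 : ℝ) ^ m)⁻¹ ≤ d₁ * (4 / 3) := mul_le_mul_of_nonneg_left g4 hd₁
        have t4 : e₀ * ∑ m ∈ range (N + 1), ((64 : ℝ) ^ m)⁻¹ ≤ e₀ * (64 / 63) := mul_le_mul_of_nonneg_left g64 he₀
        have t5 : e₁ * ∑ m ∈ range (N + 1), ((16 : ℝ) ^ m)⁻¹ ≤ e₁ * (16 / 15) := mul_le_mul_of_nonneg_left g16 he₁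
        have t6 : e₂ * ∑ m ∈ range (N + 1), ((4 : ℝ) ^ m)⁻¹ ≤ e₂ * (4 / 3) := mul_le_mul_of_nonneg_left g4 he₂
        have hc1 : (0 : ℝ) ≤ π / 2 := by positivity
        have hc2 : (0 : ℝ) ≤ π ^ 2 / (2 * Real.sqrt 2) := by positivity
        have hc3 : (0 : ℝ) ≤ π ^ 3 / 8 := by positivity
        nlinarith [mul_le_mul_of_nonneg_left (show a₀ * ∑ m ∈ range (N + 1), ((4 : ℝ) ^ m)⁻¹ + a₁ * (N + 1) ≤
            4 / 3 * a₀ + (N + 1) * a₁ by linarith) hc1,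
          mul_le_mul_of_nonneg_left (show d₀ * ∑ m ∈ range (N + 1), ((16 : ℝ) ^ m)⁻¹ + d₁ * ∑ m ∈ range (N + 1), ((4 : ℝ) ^ m)⁻¹ +
            d₂ * (N + 1) ≤ 16 / 15 * d₀ + 4 / 3 * d₁ + (N + 1) * d₂ by linarith) hc2,
          mul_le_mul_of_nonneg_left (show e₀ * ∑ m ∈ range (N + 1), ((64 : ℝ) ^ m)⁻¹ + e₁ * ∑ m ∈ range (N + 1), ((16 : ℝ) ^ m)⁻¹ +
            e₂ * ∑ m ∈ range (N + 1), ((4 : ℝ) ^ m)⁻¹ + e₃ * (N + 1) ≤ 64 / 63 * e₀ + 16 / 15 * e₁ + 4 / 3 * e₂ + (N + 1) * e₃ by linarith) hc3]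

end Summit.HubbardSuperconductivity.HubbardSuperconductivity.Theorems.EngineV8

end
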